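import Mathlib
import Literature.MathematicalPhysics.StatisticalMechanics.LennardJonesClusters
import Literature.MathematicalPhysics.StatisticalMechanics.BarlowStackingEnergy
import Literature.MathematicalPhysics.StatisticalMechanics.SeparatedShellSums
import Summits.AtomisticToContinuum.Crystallization.Theorems.SquareWellLayerCakeStackingFaultSparsityDefs
import Summits.AtomisticToContinuum.Crystallization.Theorems.SquareWellLayerCakeStackingFaultSparsitySubwindow
import Summits.AtomisticToContinuum.Crystallization.Theorems.ExcessDecayLiouvilleCoarseGrainsTrialBound
import Summits.AtomisticToContinuum.Crystallization.Theorems.PricedLinkCensusStackingHingeFarTail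
import Summits.AtomisticToContinuum.Crystallization.Theorems.SquareWellLayerCakeStackingFaultSparsityFarPasteSiteEnergy

/-!
# The far-paste inequality (stub `stub_farPaste` of `StackingFaultSparsity`, line `Sketch`)

Crux `StackingFaultSparsity` (item stmt-AtomisticToContinuum-14296, routes `SquareWellLayerCake` /
`LaminarSixThreeThree`).  For every periodic trial configuration `Q` and `η > 0` there are `L₁` and
`ε₁ > 0` such that in every Lennard-Jones ground state `x`, every window two-way `(L, ε₁)`-matched
(`L ≥ L₁`) to an exact Barlow stacking `barlowStacking a h s` (`a, h ∈ (1/2, 2)`, `s` a Hägg word)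
has `e₀(a,h) - ∑_{k ≥ 2} |J_k(a,h)| ≤ e(Q) + η`.

Proof (finite-`N` surgery).  Let `B = {j : dist (x j) (x i) ≤ L/2}`, `n = #B`.
* surgery (`surgery`): `∑_{p ∈ B} 𝓔ᵖ(x) + ∑_{p ∈ B, q ∉ B} V(|x_p - x_q|) ≤ 2 E(n)` — the double
  sum splits over `B`, `Bᶜ` (`sum_sum_eq_add_compl`), the `Bᶜ`-block is `≥ 2 E(N - n)`
  (`two_mul_groundStateEnergy_card_le`) and `E(N) < E(N - n) + E(n)` (`groundStateEnergy_add_lt`);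
* trial states (`ExcessDecayLiouvilleCoarseGrains.stub_trialBound`): `E(n) ≤ n (e(Q) + η/3)`;
* the cross term is `≥ -C L²` (`cross_inv_pow_six_le`: the area law
  `sum_cross_inv_pow_six_le_of_tail` with the far tail `stub_farTail`, and `V_LJ ≥ -r⁻⁶/6`);
* `n ≥ (L/16)³` (`count_lower_of_twoWay`, part II);
* every `p ∈ B` has its own window two-way `(L/2 - ε₁, 2ε₁)`-matched (`stub_subwindow`), so by
  part II its site energy is `≥ 2 (e₀ - ∑_{k ≥ 2} |J_k|) - C (ε₁ + L⁻³)` (`siteEnergy_matched_ge`).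
Dividing by `n` gives the claim for `ε₁ ~ η / C` and `L ≥ L₁ ~ C/η + N₀`.  All constants depend only
on the separation constant of ground states (`LennardJonesMinimalDistance_holds`, capped at
`1/2 ≤ min a h`), hence are uniform in `a, h ∈ (1/2, 2)` and in the word `s`.
-/

noncomputable section
namespace Summit.AtomisticToContinuum.Crystallization.Theorems.SquareWellLayerCake.StackingFaultSparsity
open Literature.MathematicalPhysics.StatisticalMechanics
/-- Euclidean `3`-space. [folklore] -/
local notation "E3" => EuclideanSpace ℝ (Fin 3)

/-! ## 5. The cross term -/

/-- **Cross term bound**: for a `δ₀`-separated configuration (`0 < δ₀ ≤ 1`),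
`∑_{|y_i - c| ≤ ρ} ∑_{|y_j - c| > ρ} |y_i - y_j|⁻⁶ ≤ C(δ₀) ρ²` for `ρ ≥ 1` (area law
`sum_cross_inv_pow_six_le_of_tail` of `SeparatedShellSums.lean`, fed with the dyadic far-tail bound
`PricedHcpWindowsFarTail.stub_farTail`). -/
private theorem cross_inv_pow_six_le : ∀ δ₀ : ℝ, 0 < δ₀ → δ₀ ≤ 1 → ∃ C : ℝ, 0 ≤ C ∧
    ∀ (N : ℕ) (y : Fin N → EuclideanSpace ℝ (Fin 3)),
    (∀ i j : Fin N, i ≠ j → δ₀ ≤ dist (y i) (y j)) → ∀ (c : EuclideanSpace ℝ (Fin 3)) (ρ : ℝ),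
    1 ≤ ρ → ∑ i ∈ Finset.univ.filter (fun i => dist (y i) c ≤ ρ),
      ∑ j ∈ Finset.univ.filter (fun j => ρ < dist (y j) c), (dist (y i) (y j))⁻¹ ^ 6 ≤
      C * ρ ^ 2 := by
  intro δ₀ hδ₀ hδ₁
  obtain ⟨CT, hCT0, hCT⟩ := PricedHcpWindowsFarTail.stub_farTail δ₀ hδ₀
  refine ⟨108 * δ₀⁻¹ ^ 3 * CT * (δ₀⁻¹ ^ 3 + 2), by positivity, ?_⟩
  intro N y hsep c ρ hρ
  exact sum_cross_inv_pow_six_le_of_tail hδ₀ hδ₁ hCT0 y hsep (hCT N y hsep) c hρ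

/-! ## 6. Surgery -/

/-- `E(0) = 0` (no particles, no interaction). -/
private theorem groundStateEnergy_zero' : groundStateEnergy lennardJones 3 0 = 0 := by
  unfold groundStateEnergy
  haveI : Nonempty {y : Fin 0 → EuclideanSpace ℝ (Fin 3) // Function.Injective y} :=
    ⟨⟨fun k => k.elim0, fun k => k.elim0⟩⟩
  have : (fun y : {y : Fin 0 → EuclideanSpace ℝ (Fin 3) // Function.Injective y} =>
      interactionEnergy lennardJones y.1) = fun _ => 0 :=
    funext fun y => interactionEnergy_of_subsingleton lennardJones y.1
  rw [this]
  exact ciInf_const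

/-- **Surgery inequality**: in a Lennard-Jones ground state, for every non-empty index set `B`,
`∑_{p ∈ B} 𝓔ᵖ(x) + ∑_{p ∈ B} ∑_{q ∉ B} V(|x_p - x_q|) ≤ 2 E(#B)` (`E(N) < E(N - #B) + E(#B)` and the
`Bᶜ`-block of the double sum is `≥ 2 E(N - #B)`). -/
private theorem surgery {N : ℕ} {x : Fin N → E3} (hx : IsGroundState lennardJones x)
    (B : Finset (Fin N)) (hB : 0 < B.card) :
    ∑ p ∈ B, siteEnergy lennardJones x p + ∑ p ∈ B, ∑ q ∈ Bᶜ, lennardJones (dist (x p) (x q)) ≤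
      2 * groundStateEnergy lennardJones 3 B.card := by
  classical
  -- site energies are full row sums (the diagonal term is `V_LJ(0) = 0`), split along `B`
  have hsite : ∀ p, siteEnergy lennardJones x p =
      ∑ q ∈ B, lennardJones (dist (x p) (x q)) + ∑ q ∈ Bᶜ, lennardJones (dist (x p) (x q)) := by
    intro p
    unfold siteEnergy
    rw [Finset.sum_add_sum_compl B (fun q => lennardJones (dist (x p) (x q))),
      ← Finset.add_sum_erase Finset.univ _ (Finset.mem_univ p), dist_self, lennardJones_zero,
      zero_add]
  have hLHS : ∑ p ∈ B, siteEnergy lennardJones x p =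
      ∑ p ∈ B, ∑ q ∈ B, lennardJones (dist (x p) (x q)) +
        ∑ p ∈ B, ∑ q ∈ Bᶜ, lennardJones (dist (x p) (x q)) := by
    rw [← Finset.sum_add_distrib]
    exact Finset.sum_congr rfl fun p _ => hsite p
  -- the full double sum is `2 E(N)` and splits into four blocks, the two cross blocks agree
  have h2E : 2 * interactionEnergy lennardJones x = ∑ p, ∑ q, lennardJones (dist (x p) (x q)) :=
    two_mul_interactionEnergy_eq_sum_sum lennardJones lennardJones_zero x
  have hsplit : ∑ p, ∑ q, lennardJones (dist (x p) (x q)) =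
      ∑ p ∈ B, ∑ q ∈ B, lennardJones (dist (x p) (x q)) +
        ∑ p ∈ Bᶜ, ∑ q ∈ Bᶜ, lennardJones (dist (x p) (x q)) +
        (∑ p ∈ B, ∑ q ∈ Bᶜ, lennardJones (dist (x p) (x q)) +
          ∑ p ∈ Bᶜ, ∑ q ∈ B, lennardJones (dist (x p) (x q))) :=
    sum_sum_eq_add_compl (fun p q => lennardJones (dist (x p) (x q))) B
  have hsymm : ∑ p ∈ Bᶜ, ∑ q ∈ B, lennardJones (dist (x p) (x q)) =
      ∑ p ∈ B, ∑ q ∈ Bᶜ, lennardJones (dist (x p) (x q)) := by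
    rw [Finset.sum_comm]
    exact Finset.sum_congr rfl fun p _ => Finset.sum_congr rfl fun q _ => by rw [dist_comm]
  -- the `Bᶜ` block costs at least `2 E(#Bᶜ) = 2 E(N - #B)`
  have hBc := two_mul_groundStateEnergy_card_le lennardJones lennardJones_zero
    neg_one_div_le_lennardJones hx.1 Bᶜ
  have hcardc : Bᶜ.card = N - B.card := by rw [Finset.card_compl, Fintype.card_fin]
  rw [hcardc] at hBc
  have hBN : B.card ≤ N := (Finset.card_le_univ B).trans_eq (Fintype.card_fin N)
  have hE : interactionEnergy lennardJones x = groundStateEnergy lennardJones 3 N := hx.2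
  -- binding: `E(N) ≤ E(N - #B) + E(#B)` (strict binding if `#B < N`, trivial if `#B = N`)
  have hbind : groundStateEnergy lennardJones 3 N ≤
      groundStateEnergy lennardJones 3 (N - B.card) + groundStateEnergy lennardJones 3 B.card := by
    rcases Nat.lt_or_ge B.card N with hlt | hge
    · obtain ⟨y, hy⟩ := LennardJonesGroundStatesExist_holds (N - B.card)
      obtain ⟨w, hw⟩ := LennardJonesGroundStatesExist_holds B.card
      have h := groundStateEnergy_add_lt (d := 3) (by norm_num) (Nat.sub_pos_of_lt hlt) hB hy hw
      rw [Nat.sub_add_cancel hBN] at h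
      exact h.le
    · have hBN' : B.card = N := le_antisymm hBN hge
      rw [hBN', Nat.sub_self, groundStateEnergy_zero', zero_add]
  rw [hLHS]
  linarith [hbind, hBc, h2E, hsplit, hsymm, hE]

/-! ## 7. The stub -/

/-- **Stub `stub_farPaste`** (finite-`N` far-paste surgery): for every periodic trial configuration
`Q` and `η > 0` there are `L₁` and `ε₁ > 0` such that in every Lennard-Jones ground state every
window two-way `(L, ε₁)`-matched, `L ≥ L₁`, to an exact Barlow stacking `barlowStacking a h s`,
`a, h ∈ (1/2, 2)`, has `e₀(a,h) - ∑_{k≥2}|J_k(a,h)| ≤ e(Q) + η`. -/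
theorem stub_farPaste :
    ∀ (Q : PeriodicConfiguration 3) (η : ℝ), 0 < η → ∃ (L₁ ε₁ : ℝ), 0 < ε₁ ∧ ∀ L : ℝ, L₁ ≤ L →
      ∀ (N : ℕ) (x : Fin N → E3), IsGroundState lennardJones x →
        ∀ (i : Fin N) (a h : ℝ) (s : ℤ → ℤ) (z : E3) (A : E3 →ₗᵢ[ℝ] E3), 1 / 2 < a → a < 2 →
          1 / 2 < h → h < 2 → IsHaggSeq s → z ∈ barlowStacking a h s →
          TwoWay (barlowStacking a h s) L ε₁ x i z A →
          barlowBaseEnergy lennardJones a h - ∑' k : ℕ, |barlowCoupling lennardJones a h (k + 2)| ≤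
            Q.energyPerParticle lennardJones + η := by
  intro Q η hη
  classical
  -- the separation constant of Lennard-Jones ground states, capped at `1/2 ≤ min a h`
  obtain ⟨δ, hδ, hsepGS⟩ := LennardJonesMinimalDistance_holds
  set δ₀ : ℝ := min δ (1 / 2) with hδ₀_def
  have hδ₀ : 0 < δ₀ := lt_min hδ (by norm_num)
  have hδ₀h : δ₀ ≤ 1 / 2 := min_le_right _ _
  have hδ₀δ : δ₀ ≤ δ := min_le_left _ _
  obtain ⟨CD, hCD0, hCD⟩ := siteEnergy_matched_ge δ₀ hδ₀ hδ₀h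
  obtain ⟨CE, hCE0, hCE⟩ := cross_inv_pow_six_le δ₀ hδ₀ (by linarith)
  obtain ⟨N₀, hN₀⟩ :=
    ExcessDecayLiouvilleCoarseGrains.stub_trialBound Q (η / 3) (by positivity)
  -- the tolerance `ε₁` and the scale `L₁`
  set ε₁ : ℝ := min (δ₀ / 8) (η / (6 * (CD + 1))) with hε₁_def
  have hε₁ : 0 < ε₁ := lt_min (by positivity) (by positivity)
  have hε₁δ : ε₁ ≤ δ₀ / 8 := min_le_left _ _
  have hε₁η : CD * ε₁ ≤ η / 6 := by
    have h1 : ε₁ ≤ η / (6 * (CD + 1)) := min_le_right _ _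
    have h2 : CD * ε₁ ≤ (CD + 1) * ε₁ := mul_le_mul_of_nonneg_right (by linarith) hε₁.le
    have h3 : (CD + 1) * (η / (6 * (CD + 1))) = η / 6 := by field_simp
    have h4 := mul_le_mul_of_nonneg_left h1 (by positivity : (0 : ℝ) ≤ CD + 1)
    rw [h3] at h4
    linarith
  set K : ℝ := 3 * (64 * CD + 200 * CE) / η with hK_def
  refine ⟨max (16 * ((N₀ : ℝ) + 1)) K, ε₁, hε₁, ?_⟩
  intro L hL N x hx i a h s z A ha1 ha2 hh1 hh2 hs hz hW
  have hL16N : 16 * ((N₀ : ℝ) + 1) ≤ L := (le_max_left _ _).trans hL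
  have hLK : K ≤ L := (le_max_right _ _).trans hL
  have hN₀0 : (0 : ℝ) ≤ N₀ := Nat.cast_nonneg _
  have hL16 : 16 ≤ L := by linarith
  have hL0 : 0 < L := by linarith
  set S := barlowStacking a h s with hS_def
  set w := barlowBaseEnergy lennardJones a h -
    ∑' k : ℕ, |barlowCoupling lennardJones a h (k + 2)| with hw_def
  set eQ := Q.energyPerParticle lennardJones with heQ_def
  -- separation of the ground state
  have hsep : ∀ p q : Fin N, p ≠ q → δ₀ ≤ dist (x p) (x q) := fun p q hpq =>
    hδ₀δ.trans (hsepGS N x hx p q hpq)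
  -- the half window `B` and its cardinality
  set B : Finset (Fin N) := Finset.univ.filter fun j => dist (x j) (x i) ≤ L / 2 with hB_def
  have hBmem : ∀ p ∈ B, dist (x p) (x i) ≤ L / 2 := fun p hp => (Finset.mem_filter.1 hp).2
  have hn : (L / 16) ^ 3 ≤ (B.card : ℝ) := by
    have := count_lower_of_twoWay x i ha1 ha2 hh1 hh2 hs hz hW (by linarith)
      (by linarith : 8 ≤ L / 2) (by linarith : L / 2 ≤ L)
    convert this using 2
    ring
  have hn1 : (1 : ℝ) ≤ B.card := (one_le_pow₀ (by linarith : (1 : ℝ) ≤ L / 16)).trans hn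
  have hnR : (0 : ℝ) < B.card := by linarith
  have hBpos : 0 < B.card := by exact_mod_cast hnR
  have hN₀B : N₀ ≤ B.card := by
    have h1 : (N₀ : ℝ) + 1 ≤ L / 16 := by linarith
    have h2 : ((N₀ : ℝ) + 1) ^ 3 ≤ (L / 16) ^ 3 := pow_le_pow_left₀ (by positivity) h1 3
    have h3 : (N₀ : ℝ) + 1 ≤ ((N₀ : ℝ) + 1) ^ 3 := by
      calc (N₀ : ℝ) + 1 = ((N₀ : ℝ) + 1) ^ 1 := (pow_one _).symm
        _ ≤ ((N₀ : ℝ) + 1) ^ 3 := pow_le_pow_right₀ (by linarith) (by norm_num)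
    have h4 : (N₀ : ℝ) ≤ B.card := by linarith
    exact_mod_cast h4
  -- surgery and the trial-state bound
  have hsurg := surgery hx B hBpos
  have htrial : groundStateEnergy lennardJones 3 B.card ≤ (B.card : ℝ) * (eQ + η / 3) :=
    hN₀ _ hN₀B
  -- the cross term
  have hBc : Bᶜ = Finset.univ.filter fun j => L / 2 < dist (x j) (x i) := by
    ext j
    simp [hB_def, not_le]
  have hcross : -(1 / 6 * (CE * (L / 2) ^ 2)) ≤
      ∑ p ∈ B, ∑ q ∈ Bᶜ, lennardJones (dist (x p) (x q)) := by
    have h6 := hCE N x hsep (x i) (L / 2) (by linarith)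
    rw [← hB_def, ← hBc] at h6
    have hterm : ∀ p ∈ B, ∀ q ∈ Bᶜ,
        -(1 / 6 * (dist (x p) (x q))⁻¹ ^ 6) ≤ lennardJones (dist (x p) (x q)) := by
      intro p hp q hq
      have hpq : p ≠ q := fun hpq => (Finset.mem_compl.1 hq) (hpq ▸ hp)
      have hd : 0 < dist (x p) (x q) := dist_pos.2 (hx.1.ne hpq)
      have := neg_le_lennardJones_of_le hd le_rfl
      linarith
    calc -(1 / 6 * (CE * (L / 2) ^ 2))
        ≤ -(1 / 6 * ∑ p ∈ B, ∑ q ∈ Bᶜ, (dist (x p) (x q))⁻¹ ^ 6) := by linarith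
      _ = ∑ p ∈ B, ∑ q ∈ Bᶜ, -(1 / 6 * (dist (x p) (x q))⁻¹ ^ 6) := by
          rw [Finset.mul_sum, ← Finset.sum_neg_distrib]
          refine Finset.sum_congr rfl fun p _ => ?_
          rw [Finset.mul_sum, ← Finset.sum_neg_distrib]
      _ ≤ _ := Finset.sum_le_sum fun p hp => Finset.sum_le_sum fun q hq => hterm p hp q hq
  -- the site energies of the particles of `B`
  have hR2 : (2 : ℝ) ≤ L / 2 - ε₁ := by linarith
  have hsite : ∀ p ∈ B,
      2 * w - CD * (2 * ε₁ + (L / 2 - ε₁)⁻¹ ^ 3) ≤ siteEnergy lennardJones x p := by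
    intro p hp
    have hpi : dist (x p) (x i) ≤ L / 2 := hBmem p hp
    obtain ⟨P, hPS, hpP⟩ := hW.2 p (hpi.trans (by linarith))
    have hW' : TwoWay S (L / 2 - ε₁) (2 * ε₁) x p P A :=
      stub_subwindow x i p S z P A L (L / 2 - ε₁) ε₁ hε₁.le (by linarith) (by linarith) hW hPS
        hpi hpP
    obtain ⟨k', i', j', rfl⟩ := hPS
    exact hCD (L / 2 - ε₁) (2 * ε₁) hR2 (by positivity) (by linarith) N x hsep p a h s k' i' j' A
      ha1 hh1 hs hW'
  have hsite_sum : (B.card : ℝ) * (2 * w - CD * (2 * ε₁ + (L / 2 - ε₁)⁻¹ ^ 3)) ≤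
      ∑ p ∈ B, siteEnergy lennardJones x p := by
    have := Finset.card_nsmul_le_sum B (fun p => siteEnergy lennardJones x p) _ hsite
    rwa [nsmul_eq_mul] at this
  -- the error terms
  have hRinv : (L / 2 - ε₁)⁻¹ ^ 3 ≤ 64 / L := by
    have h1 : L / 4 ≤ L / 2 - ε₁ := by linarith
    have h2 : (L / 2 - ε₁)⁻¹ ^ 3 ≤ (L / 4)⁻¹ ^ 3 :=
      pow_le_pow_left₀ (inv_nonneg.2 (by linarith)) (inv_anti₀ (by positivity) h1) 3
    have h3 : (L / 4)⁻¹ ^ 3 = 64 / L ^ 3 := by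
      rw [inv_div, div_pow]
      norm_num
    have h4 : (64 : ℝ) / L ^ 3 ≤ 64 / L := by
      apply div_le_div_of_nonneg_left (by norm_num) hL0
      calc L = L * 1 * 1 := by ring
        _ ≤ L * L * L := by gcongr <;> linarith
        _ = L ^ 3 := by ring
    linarith [h3.le.trans h4]
  have e1 : (B.card : ℝ) * (CD * (2 * ε₁)) ≤ (B.card : ℝ) * (η / 3) :=
    mul_le_mul_of_nonneg_left (by linarith) hnR.le
  have e2 : (B.card : ℝ) * (CD * (L / 2 - ε₁)⁻¹ ^ 3) ≤ (B.card : ℝ) * (64 * CD / L) :=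
    mul_le_mul_of_nonneg_left (by
      calc CD * (L / 2 - ε₁)⁻¹ ^ 3 ≤ CD * (64 / L) := mul_le_mul_of_nonneg_left hRinv hCD0
        _ = 64 * CD / L := by ring) hnR.le
  have e3 : 1 / 6 * (CE * (L / 2) ^ 2) ≤ (B.card : ℝ) * (200 * CE / L) := by
    have h0 : 0 ≤ CE * L ^ 2 := by positivity
    calc 1 / 6 * (CE * (L / 2) ^ 2) ≤ (L / 16) ^ 3 * (200 * CE / L) := by
          rw [show (L / 16) ^ 3 * (200 * CE / L) = 200 / 4096 * (CE * L ^ 2) by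
            field_simp; ring]
          linarith
      _ ≤ (B.card : ℝ) * (200 * CE / L) := mul_le_mul_of_nonneg_right hn (by positivity)
  have e4 : (64 * CD + 200 * CE) / L ≤ η / 3 := by
    rw [div_le_iff₀ hL0]
    have h1 : K * η ≤ L * η := mul_le_mul_of_nonneg_right hLK hη.le
    have h2 : K * η = 3 * (64 * CD + 200 * CE) := by rw [hK_def]; field_simp
    rw [h2] at h1
    linarith
  have e5 : (B.card : ℝ) * (64 * CD / L) + (B.card : ℝ) * (200 * CE / L) ≤
      (B.card : ℝ) * (η / 3) := by
    rw [← mul_add, show 64 * CD / L + 200 * CE / L = (64 * CD + 200 * CE) / L by ring]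
    exact mul_le_mul_of_nonneg_left e4 hnR.le
  -- assembly
  by_contra hcon
  rw [not_le] at hcon
  have hlt : (B.card : ℝ) * (eQ + η) < (B.card : ℝ) * w := mul_lt_mul_of_pos_left hcon hnR
  have hnη : 0 ≤ (B.card : ℝ) * η := by positivity
  linarith [hsurg, hsite_sum, hcross, htrial, e1, e2, e3, e5, hlt]

end Summit.AtomisticToContinuum.Crystallization.Theorems.SquareWellLayerCake.StackingFaultSparsity

end
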